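import Mathlib
import HarnessLib
import HarnessLib.Audit
import Summits.AtomisticToContinuum.Statement
import Literature.MathematicalPhysics.KineticTheory.InfiniteChainDynamics
import Literature.MathematicalPhysics.KineticTheory.InfiniteChainInvariantStates
import Literature.MathematicalPhysics.KineticTheory.LangevinChainNESSHolds
import Summits.AtomisticToContinuum.FouriersLaw.Theorems.EmbeddedDrudeMourreNessUnique
import Summits.AtomisticToContinuum.FouriersLaw.Theorems.OddSectorIrreversibilityCorrectorTheoryUniformMixing
import Summits.AtomisticToContinuum.FouriersLaw.Theorems.EmbeddedDrudeMourreAbelThermodynamicLimitOfLowerBound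
import HarnessLib.Audit.Status.Attr

/-!
Route: HoelderEscapeProfile

DORMANT since 2026-08-26T09:02:18Z (reconciler: no traction for 8.4 d (last activity item-evidence-added at 2026-08-17T22:22:48Z); parked, not closed — `ledger route dormant route-AtomisticToContinuum-HoelderEscapeProfile --off` to reac) — unstaffed, not closed; items shared with open routes are served there. `ledger route dormant <id> --off` reactivates.

# Route HoelderEscapeProfile — Guarneri–Combes–Last for heat — one local ½-Hölder exponent plus a
wavenumber pigeonhole give κ>0, an Abel spread ceiling gives κ<∞

It suffices to show X = LocalEnergyHalfHoelder ∧ CornerNoDip ∧ AbelSpreadCeiling ∧ AbelRegularity ∧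
AbelThermodynamicLimit ∧ FibreCalculus ∧ SymmetricSetup. Arena (shared verbatim with CoercivePulse /
CurrentTiltQuench): the infinite pinned chain in its shift- and momentum-reversal-invariant Gibbs
state μ_T with a μ_T-preserving shift-covariant dynamics (SymmetricSetup), split-bond site energy
h_x, pulse S(x,t) = Cov(h_0, h_x∘φ_t), its ABEL ESCAPE PROFILE S̄_ν(x) = ν∫₀^∞e^(−νt)S(x,t)dt, the
profile transform f̂_ν(k) = Σ_x cos(kx)S̄_ν(x), the static structure factor χ(k) = Σ_x cos(kx)S(x,0)
(χ = χ(0) = T²c_v) and the FIBRED ABELIAN CONDUCTIVITY 𝒢_ν(k) = ∫₀^∞e^(−νt)Σ_x cos(kx)⟨j_0,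
j_x∘φ_t⟩dt, whose value at k = 0 is the Abel Green–Kubo mean A(ν) = ∫₀^∞e^(−νt)C_T(t)dt.
LocalEnergyHalfHoelder (K1 of card guarneri-escape-profile-positivity, the NEW input): the return
value Ψ(ν) = S̄_ν(0) of ONE local observable obeys Ψ(ν) ≤ C√ν (½-Hölder site-energy spectral measure
at 0). FibreCalculus (Bochner f̂_ν ≥ 0, conservation Σ_x S̄_ν = χ > 0, Parseval ∫f̂_ν = 2πΨ, the
k-space conservation law χ(k) − f̂_ν(k) = (2−2cos k)𝒢_ν(k)/ν and Helfand–Abel A(ν) = (ν/2)(Σx²S̄_ν −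
Σx²S(·,0))) makes the WAVENUMBER PIGEONHOLE run inside `closes`: some 0 < k* ≤ 8πC√ν/χ has f̂_ν(k*)
≤ χ/2, hence 𝒢_ν(k*) ≥ χ³/(256π²C²) inside the diffusive corner; CornerNoDip (K2: no dip of 𝒢_ν at k
= 0 on the parabolic scale |k| ≤ a√ν) moves it to liminf A(ν) ≥ χ³/(512π²C²) > 0; AbelSpreadCeiling
(Σx²S̄_ν(x) ≤ B/ν, the Abel twin of CoercivePulse.LinearCeiling) gives limsup A(ν) ≤ B/2;
AbelRegularity (shared, non-oscillation) gives the limit κ₀T²; AbelThermodynamicLimit (shared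
bridge) + the finite-N frame (landed, kernel-closed: Literature steady-state existence,
Theorems.nessUnique_proof, Corrector.openChainGreenKubo_holds — invoked inside `closes`, not
hypotheses) give FouriersLaw. Cards realised: guarneri-escape-profile-positivity (spine);
kadanoff-martin-corner-continuity (its corner ray = K2); herglotz-current-spectral-measure (its
OhmicLowerBracket is what K1 + pigeonhole deliver).
Lean: `LocalEnergyHalfHoelder ∧ CornerNoDip ∧ AbelSpreadCeiling ∧ AbelRegularity ∧
AbelThermodynamicLimit ∧ FibreCalculus ∧ SymmetricSetup`

## Assembly
The DECIDING THEOREM `closes : LocalEnergyHalfHoelder → CornerNoDip → AbelSpreadCeiling →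
AbelRegularity → AbelThermodynamicLimit → FibreCalculus → SymmetricSetup → FouriersLaw` is PROVED
sorry-free (planner glue.lean ≈ 170 lines; local replica lean check rc 0, axioms
propext/Classical.choice/Quot.sound, #h21_check_closes ok with non_crux [], #h21_route_deps 43
constants 0 unproved): its hypotheses are the SEVEN CRUXES and nothing else (crux-only rule,
route-repair 2026-08-16 — the rev-1/2 support hypotheses NessUnique / FiniteResponseOfUnique,
duplicates of the proved stmt-0741 / stmt-0717, are dropped). Imports: Literature
InfiniteChainDynamics, InfiniteChainInvariantStates, LangevinChainNESSHolds + the two proof modules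
Theorems.EmbeddedDrudeMourreNessUnique and
Theorems.OddSectorIrreversibilityCorrectorTheoryUniformMixing (pattern of CoercivePulse rev 4 /
CageBudgetFekete rev 2; the ledger dependency cone stays at 0 unproved — the unproved named facts in
those modules' IMPORT closure, Barriers.MacroErgodicityHypothesis and the Langevin-SDE facts, are
referenced by no item and not by `closes`). Inside: (1) `corner`, pure real analysis — the
wavenumber pigeonhole (f̂_ν continuous by `continuous_tsum`, ≥ 0, f̂_ν(0) = χ, ∫_(−π)^π f̂_ν = 2πΨ ≤
2πC′√ν with C′ = max C 1: if f̂_ν > χ/2 on [0, K], K = 8πC′√ν/χ, then ∫₀^K f̂_ν ≥ 4πC′√ν > ∫_(−π)^π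
f̂_ν — contradiction, so some 0 < k* ≤ K has f̂_ν(k*) ≤ χ/2), the corner bound (2−2cos k* ∈ (0,
k*²], χ(k*) ≥ 3χ/4 by continuity of χ(·) at 0, hence 𝒢_ν(k*) ≥ χ³/(256π²C′²) and, by CornerNoDip
with a = 8πC′/χ, ε = χ³/(512π²C′²), A(ν) = 𝒢_ν(0) ≥ ε), the Helfand–Abel upper bound A(ν) ≤ |B|/2 +
|M₀|/2 eventually in 𝓝[>]0, and the Abelian dichotomy (AbelRegularity: the +∞ branch contradicts the
ceiling; the finite branch has limit ≥ ε > 0); (2) for each T > 0, SymmetricSetup gives (μ_T, D),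
FibreCalculus the objects and identities, K1/K2/ceiling/regularity feed `corner`, giving the Abelian
witness (μ_T, D, κ₀/T²); (3) clause (i) from Literature `pinnedChain_exists_isSteadyState` +
`Theorems.nessUnique_proof`; clause (ii): D_N exists for N ≤ 1 trivially (no bonds, D_N = 0) and for
N ≥ 2 by `Theorems.OddSectorIrreversibility.Corrector.openChainGreenKubo_holds`, and
AbelThermodynamicLimit sends D_N → κ(T).

Rationale: WHY THIS LINE. TRANSPLANT of the Guarneri–Combes–Last inequality (one-body quantum dynamics: an
α-Hölder spectral measure forces spreading ≳ t^α; doi:10.1209/0295-5075/10/2/001,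
doi:10.1006/jfan.1996.0155, doi:10.1023/a:1007610717491) to the Koopman group of the equilibrium
pinned chain, with positivity of |ψ|² replaced by BOCHNER POSITIVITY IN SPACE of the Abel-averaged
energy–energy correlation (φ_ν(L) = ν²(ν²−L²)⁻¹ ≥ 0 makes x ↦ S̄_ν(x) positive-definite, so f̂_ν ≥
0) and normalisation replaced by energy conservation (f̂_ν(0) = χ): a conserved profile that has
provably LEFT the origin (Ψ(ν) ≤ C√ν) cannot stay broad in k, and by the exact k-space conservation
law its k-width IS the corner conductivity — positivity of κ from ONE local decay exponent, with the
explicit constant χ³/(512π²C²), no sign conjecture on any correlation, no test functions, no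
subadditivity, no rate. Imported areas: spectral theory of anomalous quantum transport (Guarneri
1989, Last 1996, Schulz-Baldes–Bellissard 1998 doi:10.1142/s0129055x98000021,
Barbaroux–Germinet–Tcheremchantsev 2001 doi:10.1215/s0012-7094-01-11015-6), discrete Fourier
analysis on the circle, Abelian (Laplace) Green–Kubo calculus (BonettoLebowitzReyBellet2000 §6.3/§7,
Helfand1960, arXiv:1103.2835). What no open route does: every Green–Kubo route asks for DECAY of
current (odd-sector) correlations or (CoercivePulse) for ENVELOPES of the k = 0 second moment earned
from an ellipticity inequality, and GriffithsLimitExchange needs the SIGN of a kernel; here the only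
dynamical inputs are the return exponent of one even local observable (K1) and a one-sided corner
condition (K2). The two refuted FouriersLaw statements (OddCorrectorDecay stmt-9139, DiluteCell
FarFieldGaussianity stmt-12890) concern other objects.

RANKED CRUXES. #2 LocalEnergyHalfHoelder (crux) — K1 of card guarneri-escape-profile-positivity —
for pinnedChain (ω₂, lam, β > 0, any γ), every T > 0 and every guarded (μ_T, D): if e^(−νt)S(0,t) is
integrable on (0,∞) for all ν > 0, then ∃ C, ν₀ > 0 with ν∫₀^∞e^(−νt)Cov(h_0, h_0∘φ_t)dt ≤ C√ν for 0
< ν ≤ ν₀ — the on-site energy returns at least diffusively fast in Abel mean (the site-energy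
spectral measure is ½-Hölder at 0). [deps: FibreCalculus, SymmetricSetup] [difficulty: open-problem]
(why it might fail: it forbids even a partial atom of σ_e at 0 (a fraction of site energy that never
leaves) and any return slower than t^(−1/2); in the anticontinuum window lam·T ≫ 1 De
Roeck–Huveneers plateaux make C(T) astronomically large; no t^(−1/2) return law is proved for any
deterministic anharmonic lattice.) [doi:10.1006/jfan.1996.0155, DeRoeckHuveneers2015, Zhao2006,
doi:10.1209/0295-5075/10/2/001]
#3 CornerNoDip (crux) — K2 of the card (one-sided, sign-free form) — for every guarded (μ_T, D) with
absolutely convergent current correlations and e^(−νt)Σ_x cos(kx)⟨j_0,j_x∘φ_t⟩ integrable: for every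
a > 0 and ε > 0 there is ν₀ > 0 such that 𝒢_ν(k) ≤ 𝒢_ν(0) + ε for all 0 < ν ≤ ν₀ and |k| ≤ a√ν — the
fibred Abelian conductivity has no dip at k = 0 on the parabolic scale (diffusive calibration 𝒢_ν(k)
= χDν/(ν+Dk²) ≤ 𝒢_ν(0)). Structure: 𝒢_ν(k) − 𝒢_ν(0) = −Σ_x 2sin²(kx/2)G_ν(x) with G_ν(x) =
∫e^(−νt)⟨j_0,j_x∘φ_t⟩dt, so the short-range part of G_ν (any sign) moves 𝒢_ν by O(a²ν) only and the
crux is a SIGN/continuity condition on the LONG-RANGE (|x| ≳ ν^(−½)) part alone (hydrodynamically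
(χ/2)√(Dν)e^(−|x|√(ν/D)) > 0); sufficient: that part non-negative, or joint corner continuity à la
Kadanoff–Martin. [deps: FibreCalculus, SymmetricSetup] [difficulty: open-problem] (why it might
fail: anti-correlated currents at hydrodynamic range (negative long-range part of G_ν, an
"anti-Drude" dip of the k = 0 mode) are excluded only phenomenologically; G_ν(±1) is already
negative statically (Cov(V′(r_0),V′(r_1)) < 0), so no pointwise sign can be used; nothing proved for
the quartic chain.) [BonettoLebowitzReyBellet2000, Spohn1991, Helfand1960, arXiv:1103.2835]
#4 AbelSpreadCeiling (crux) — finiteness input, Abel twin of CoercivePulse.LinearCeiling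
(stmt-15383; implied by it given PulseCalculus): for every guarded (μ_T, D), if e^(−νt)S(x,t) is
integrable for all x, ν > 0 and Σ_x(1+x²)|S̄_ν(x)| < ∞, then ∃ B, ν₀ > 0 with Σ_x x²S̄_ν(x) ≤ B/ν
for 0 < ν ≤ ν₀ — the Abel-averaged pulse spreads at most diffusively (calibration B = 2χD; FALSE at
the harmonic member, where Σx²S̄_ν ≍ ν^(−2): the ballistic delimiter). [deps: FibreCalculus,
SymmetricSetup] [difficulty: open-problem] (why it might fail: super-diffusive episodes (a
quasi-conserved phonon mode at low T, rare supersonic quartic-bond pulses, Lévy-walk-like precursor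
mass) could make νΣx²S̄_ν unbounded along a sequence; expected false only at lam·β = 0 but
unproved.) [Helfand1960, arXiv:1103.2835, Dhar2008, RiederLebowitzLieb1967]
#5 AbelRegularity (crux) — SHARED verbatim with CoercivePulse (stmt-AtomisticToContinuum-15384): for
the guarded (μ_T, D) with absolutely convergent correlations and e^(−νt)C_T integrable, the Abel
means A(ν) converge in ℝ as ν ↓ 0 OR tend to +∞ — only oscillation is forbidden (value +∞ excluded
by AbelSpreadCeiling, value 0 by K1 + K2). [deps: FibreCalculus, SymmetricSetup] [difficulty: L]
(why it might fail: lacunary/oscillating spectral mass of the current at ω = 0 (alternating power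
laws on dyadic shells) would make the Poisson/Abel averages oscillate; nothing known for
deterministic chains excludes it.) [BonettoLebowitzReyBellet2000, Spohn1991, Mazur1969, Widder1941]
#6 AbelThermodynamicLimit (crux) — SHARED verbatim (stmt-AtomisticToContinuum-12596; CoercivePulse /
EmbeddedDrudeMourre / PorousMediumCorner): under weak-NESS uniqueness, an Abelian Green–Kubo witness
(Gibbs μ_T, preserving dynamics with absolutely convergent correlations, κ > 0 with
T⁻²∫₀^∞e^(−νt)C_T → κ) can be chosen so that every steady-state family's finite-N response
coefficients converge to κ (κ_BLR = κ_GK in Abel form). [deps: LocalEnergyHalfHoelder, CornerNoDip,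
AbelSpreadCeiling, AbelRegularity, FibreCalculus, SymmetricSetup] [difficulty: open-problem] (why it
might fail: κ = κ_GK is unproved even formally (BLR §7); needs N-uniform low-frequency control of
the thermostatted chain + o(1) contact layers while the open-chain gap closes like N⁻³
(BeckerMenegaki2022).) [BonettoLebowitzReyBellet2000, KunduDharNarayan2009, Dhar2008,
BeckerMenegaki2022, ReyBellet2003]
#7 FibreCalculus (crux) — INFINITE-VOLUME FIBRE CALCULUS of the escape profile, minimal form (the
identities (I1)–(I4) of the card plus Helfand–Abel, exactly what `closes` consumes): for every
guarded (μ_T, D): absolutely convergent current correlations at every t; e^(−νt)C_T, e^(−νt)S(x,t),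
e^(−νt)Σ_x cos(kx)G(x,t) integrable on (0,∞); Σ_x(1+x²)|S̄_ν(x)| < ∞ and Σ_x(1+x²)|S(x,0)| < ∞
(light cone + Gibbs clustering); χ = Σ_x S(x,0) > 0 and conservation Σ_x S̄_ν(x) = χ; BOCHNER
f̂_ν(k) ≥ 0 (x ↦ S̄_ν(x) positive-definite via ν∫₀^∞e^(−νt)Cov(g,g∘φ_t) ≥ 0, no Stone theorem
needed); Parseval at 0: ∫_(−π)^π f̂_ν = 2πS̄_ν(0); the k-space conservation law χ(k) − f̂_ν(k) =
(2−2cos k)𝒢_ν(k)/ν (from ∂ₜ²S = Δ_xG, S even in t by momentum reversal); Helfand–Abel ∫₀^∞e^(−νt)C_T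
= (ν/2)(Σ_x x²S̄_ν(x) − Σ_x x²S(x,0)). [deps: SymmetricSetup] [difficulty: L] (why it might fail:
needs Abel-weighted light-cone bounds Σ_x(1+x²)|S(x,t)| ≲ (1+t)^m for the deg V′ = 3 infinite
dynamics plus Gibbs clustering, joint measurability of the flow and the derivative exchanges behind
∂ₜ²S = Δ_xG — printed for no quartic chain as typed.) [LanfordLebowitzLieb1977, ButtaMarchioro2016,
ButtaEtAl2007, Helfand1960, arXiv:1103.2835, BonettoLebowitzReyBellet2000]
#8 SymmetricSetup (crux) — SHARED verbatim (stmt-AtomisticToContinuum-11036; CoercivePulse /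
CurrentTiltQuench / NoHiddenChargesKubo) — de-vacuifier: for ω₂, lam, β > 0 (any γ) and T > 0 there
are a shift- and momentum-reversal-invariant DLR Gibbs state μ_T and an InfiniteChainDynamics
preserving μ_T whose flow commutes with the shift μ_T-a.e. [difficulty: L] (why it might fail:
InfiniteChainDynamics demands genuine orbits AND uniqueness within an invariant carrier of full
μ_T-measure and PreservesMeasure invariance of the DLR state under the a.e. flow; for deg V′ = 3 LLL
1977 Thm 1 fails (A4), Thm 4 unvendored, invariance printed only for severed flows.)
[LanfordLebowitzLieb1977, ButtaMarchioro2016, ButtaEtAl2007, Georgii2011,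
BonettoLebowitzReyBellet2000]

TWO-LAYER PLAN. Foreseen glued splits (none filed now): LocalEnergyHalfHoelder ⇐ DyadicReturnBound
(Cesàro on-site bound (1/t)∫₀ᵗS(0,s)ds ≤ C′t^(−1/2), the time-domain form) → AbelFromCesaro (Abel ≤
Cesàro majorant, real analysis) → LocalEnergyHalfHoelder; below that, DyadicReturnBound in the
kinetic window lam·T ≪ 1 from the positive linearised pinned-phonon Boltzmann semigroup
(doi:10.2140/paa.2020.2.203) + persistence. CornerNoDip ⇐ ShortRangeHarmless (Σ_{|x|≤R(ν)}
x²|G_ν(x)| = o(1/ν): the short-range part moves 𝒢_ν by o(1) on |k| ≤ a√ν) → LongRangeKernelSign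
(G_ν(x) ≥ 0 for |x| > R(ν): the transform of the non-negative tail is maximal at 0) → CornerNoDip,
OR ⇐ the corner-continuity ray of card kadanoff-martin-corner-continuity. AbelSpreadCeiling ⇐
CoercivePulse.LinearCeiling + PulseCalculus (Laplace transform of M(t) ≤ M(t₃) + b(t−t₃)) →
AbelSpreadCeiling (one Abelian lemma). FibreCalculus ⇐ Bochner clause (PROVABLE NOW from measure
preservation: ν∫e^(−νt)F_g ≥ 0 via the doubly-integrated positive-type lemma of
InfiniteChainCurrentPositiveType) + light-cone/clustering clauses + the two identities.

KILL CRITERIA. A partial atom of the site-energy spectral measure at 0 for pinnedChain (on-site Abel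
return Ψ(ν) ↛ 0, e.g. from a hidden even quasi-local charge overlapping h_0) refutes
LocalEnergyHalfHoelder — close `refuted:LocalEnergyHalfHoelder` (the mechanism is then silent,
correctly: such a chain is not a normal conductor at that T, and the witness goes to
HiddenChargeMazur-type negative routes). A certified dip 𝒢_ν(0) < 𝒢_ν(k) − ε on |k| ≲ √ν refutes
CornerNoDip AS TYPED — pivot by restating K2 in the two-sided Kadanoff–Martin corner-continuity form
on the ray the pigeonhole actually needs (|k| ≤ 8πC′√ν/χ). AbelSpreadCeiling refuted
(super-diffusive Abel spread at lam, β > 0) kills finiteness for EVERY Green–Kubo route (and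
CoercivePulse.LinearCeiling with it) — close. AbelRegularity / AbelThermodynamicLimit refuted break
every Abelian GK route including this one. FibreCalculus or SymmetricSetup refuted AS TYPED is a
vocabulary artefact (temperedness / measurability guard) to be repaired with CoercivePulse, not a
kill. FourierGreenKubo's GreenKubo (stmt-0703) proved elsewhere moots K1/K2/ceiling;
CoercivePulse.LinearSpread proved elsewhere moots K1 + K2 (both give liminf A > 0).

NOT DECOMPOSED YET. The constants (C(T) in the kinetic window ≍ (lam·T)-dependence matching κ ≍
(lam·T)⁻²; B = 2χD), the Cesàro-vs-Abel forms of K1, the sufficient conditions for K2 (long-range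
sign of G_ν vs corner continuity; the range split R(ν)), the m ≥ 1 Carathéodory–Toeplitz hierarchy
of certified corner lower bounds (finitely many local Abel correlations S̄_ν(x), |x| ≤ m, constrain
f̂_ν further), the ring (finite-N) version of every identity (k-grid 2π/N ≤ K_ν ~ √ν, card P1/P2)
and any use of the open chain directly — all layer-2 or other routes.

CHEAPEST FALSIFIER. The harmonic member in closed form (lookup/paper computation, done): stationary
phase on ω(k) = √(ω₂ + 4sin²(k/2)) gives |Cov(q_0(t), q_0(0))| ≲ t^(−1/2), so S_harm(0,t) = 2ΣCov² ≲
t^(−1), i.e. α_harm = 1, Ψ ~ ν log(1/ν): K1 FAILS at lam = β = 0 and the pigeonhole then certifies a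
DIVERGENT corner conductivity — consistent with `not_fouriersLawFor_harmonic` (the line cannot prove
the false harmonic statement). Next cheapest (MD, card jobs j002581 T=1 / j002583 T=5, N = 256
pinned ring, queued at the card's filing; not readable from this seat): does √t·(1/t)∫₀ᵗS(0,s)ds
plateau (K1's exponent ½) and is 𝒢_ν(k) maximal at k = 0 near the corner (K2)? In-Lean cheap check
available now: none (K1/K2 are infinite-time statements); the deciding theorem itself is checked (rc
0).

NUMBERS. Diffusive calibration: S̄_ν(x) = (χ/2)(Dν)^(−1/2)·e^(−|x|√(ν/D))(1+o(1)), Ψ(ν) = χ/(2√D)·√ν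
so C = χ/(2√D); f̂_ν(k) = χν/(ν+Dk²); 𝒢_ν(k) = χDν/(ν+Dk²), A(ν) → χD = κT² (χ = T²c_v, D = κ/c_v);
the certified constant is ε = χ³/(512π²C′²) = χD/(128π²) — a factor 128π² below the truth, constants
deliberately not optimised (card: 8π² with the sharp window). Harmonic member: α = 1, Ψ ~ ν
log(1/ν), Σx²S̄_ν ≍ ν^(−2) (M ≈ 0.19t², CoercivePulse job j002001). Kinetic corner: κ ≍ (lam·T)⁻²
(AokiLukkarinenSpohn2006 (3.28)) so C(T) must blow up like (lam·T) as lam·T → 0. Items at open: 8 (7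
cruxes + assembly); after the two route-repairs of 2026-08-16 again 8 (7 cruxes + assembly; the
interim duplicate proved-frame supports NessUnique / FiniteResponseOfUnique dropped), ledger
dependency cone 43 project constants, 0 unproved.

DEFINITION REQUESTS. None: every item is typed over InfiniteChainDynamics / IsChainGibbsMeasure /
IsShiftInvariant / shift / bondCurrentZ / currentCorrelation / HasAbsConvergentCorrelation (fibred
objects bound by defining equations inside each item, as in CoercivePulse). A later convenience
definition `abelEscapeProfile` / `fibredAbelConductivity` under
Summits/AtomisticToContinuum/FouriersLaw/Theorems would shorten the items; not needed by provers.

Novelty: Searches (2026-08-16, this seat; plus the card's log of 2026-08-15 and the mechanism critic's of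
2026-08-16): `lit search --hybrid "Hölder continuity spectral measure lower bound diffusion constant
conserved quantity classical lattice Green-Kubo"` (8 book rows: Kipnis–Landim, Gaspard, Da
Prato–Zabczyk… — tools/context only); `lit search --source crossref "Guarneri Combes theorem
classical statistical mechanics conserved density diffusion lower bound"` (8;
doi:10.1023/a:1007610717491 Guarneri–Schulz-Baldes 1999 intermittent lower bound — one-body quantum;
doi:10.1016/0378-4371(90)90330-u Casati–Guarneri–Shepelyansky 1990 — kicked rotor, unrelated); `lit
search --source arxiv "lower bound thermal conductivity anharmonic chain spectral measure Hölder"`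
(0); `lit galaxy search "Guarneri bound" --star all` (1: pdf:578349040 = cond-mat/9706239
Schulz-Baldes–Bellissard); `lit galaxy search "spectral measure Hölder continuity heat conduction"
--star all` (0); plain `lit search` local leg DOWN (searchd connection reset, logged in NOTES.md);
grep of all 81 FouriersLaw theses for Guarneri / Hölder / pigeonhole / Bochner-in-k as a lever
(none: CoercivePulse = Helfand envelopes via Nash, GriffithsLimitExchange = kernel sign,
AffineAnchorRing = spectral TYPE of the current by dilation symmetry, HeatModeWeylLaw = heat-mode
relaxation spectrum); `lean search --decl` on every constant (all resolve; Sketch.lean rc 0).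
Nearest prior art found: doi:10.1209/0295-5075/10/2/001 (Guarneri 1989), doi  [refs: 10.1023/a:1007610717491, 10.1016/0378-4371(90, 10.1209/0295-5075/10/2/001, 10.1006/jfan.1996.0155, 10.1142/s0129055x98000021, 10.1215/s0012-7094-01-11015-6, 10.1103/PhysRevLett.96.140602, doi:10.1023/a, doi:10.1016/0378-4371, doi:10.1209/0295-5075/10/2/001, doi:10.1006/jfan.1996.0155, doi:10.1142/s0129055x98000021, doi:10.1215/s0012-7094-01-11015-6, doi:10.1103/PhysRevLett.96.140602]

Barriers (technique_class: spectral-hoelder-regularity, bochner-k-pigeonhole): - technique_class: spectral-hoelder-regularity, bochner-k-pigeonhole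
- Literature.Barriers.AtomisticToContinuum.HarmonicChainBallisticFlux: detected, not contradicted —
the harmonic member has on-site exponent α = 1 (K1 false, AbelSpreadCeiling false), and with α = 1
the pigeonhole certifies a DIVERGENT corner conductivity; the line cannot prove the false statement
`not_fouriersLawFor_harmonic` excludes.
- Literature.Barriers.AtomisticToContinuum.Mazur1969_inequality: a hidden conserved charge
overlapping h_0 gives σ_e an atom (K1 void) and one overlapping J gives a Drude floor
(AbelSpreadCeiling void, AbelRegularity's +∞ branch) — the mechanism is silent in their class, never
false.
- Literature.Barriers.AtomisticToContinuum.HasBoundedResponse: (FixedLengthNoConductivityControl)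
evaded in kind — no fixed-N tool is asked to control N; N enters only through the shared bridge
AbelThermodynamicLimit, where the barrier is conceded (open-problem).
- Literature.Barriers.AtomisticToContinuum.LowTemperatureWeakAnharmonicity: no expansion in lam, β
or T; the bound is non-perturbative in form and only as good as K1's constant C(T), which must blow
up like lam·T → 0 where kinetic theory would have to supply it — conceded for the constant, not for
the mechanism.
- Literature.Barriers.AtomisticToContinuum.DeRoeckHuveneers2015_thm2: it does not evade it; the bet
is that localisation in the window lam·T ≫ 1 (β·T ≲ 1) is only asymptotic — K1 with a huge but
finite C, De Roeck–Huveneers' own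

History (route lifecycle, newest last):
- 2026-08-16T18:18:02Z · rev 2: restated Assembly (stmt-AtomisticToContinuum-16012) — route-repair: Assembly restated to the type of the re-certified `closes` (9 hypotheses: 7 cruxes + NessUnique + FiniteResponseOfUnique) (planner-rrepair-AtomisticToContinuum-HoelderEs-cb38dbb7-0)
- 2026-08-16T18:38:01Z · rev 3: restated Assembly (stmt-AtomisticToContinuum-16313) — route-repair glue.non-crux-hypothesis (rbadge, gen 1): CRUX-ONLY closes (hK1 hND hSC hAR hTL hFC hSet : FouriersLaw) — the seven cruxes, nothing else; finite-N (planner-rbadge-AtomisticToContinuum-HoelderEsc-cb38dbb7-0)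
- 2026-08-16T18:38:01Z · rev 3: dropped NessUnique, FiniteResponseOfUnique — route-repair glue.non-crux-hypothesis (rbadge, gen 1): CRUX-ONLY closes (hK1 hND hSC hAR hTL hFC hSet : FouriersLaw) — the seven cruxes, nothing else; finite-N (planner-rbadge-AtomisticToContinuum-HoelderEsc-cb38dbb7-0)
- 2026-08-26T09:02:18Z · DORMANT — reconciler: no traction for 8.4 d (last activity item-evidence-added at 2026-08-17T22:22:48Z); parked, not closed — `ledger route dormant route-AtomisticToConti (operator:999:2735012)

sub-problem: FouriersLaw · status: dormant · opened planner-plan-novel-AtomisticToContinuum-Fourier-51cdba3b-v2-g4-0 2026-08-16T17:38:28Z · rev 5 · ledger route-AtomisticToContinuum-HoelderEscapeProfile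
GENERATED by the gate from the ledger (D-0016/17). Provers cite these decls: `theorem foo : Summit.AtomisticToContinuum.FouriersLaw.Theses.HoelderEscapeProfile.<Decl> := …` in Summits/AtomisticToContinuum/FouriersLaw/Theorems/<Name>.lean.
-/

namespace Summit.AtomisticToContinuum.FouriersLaw.Theses.HoelderEscapeProfile

open scoped BigOperators Topology Manifold Classical MeasureTheory ProbabilityTheory Matrix InnerProductSpace ComplexConjugate ContinuousMap
open Filter Set Function TopologicalSpace MeasureTheory

attribute [summit_statement] _root_.FouriersLaw

/-- item stmt-AtomisticToContinuum-16008 · crux · rank 2 · open · by planner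
why it might fail: it forbids even a partial atom of σ_e at 0 (a fraction of site energy that never leaves) and any return slower than t^(−1/2); in the anticontinuum window lam·T ≫ 1 De Roeck–Huveneers plateaux make C(T) astronomically large; no t^(−1/2) return law is proved for any deterministic anharmonic lattice.
sources: doi:10.1006/jfan.1996.0155, DeRoeckHuveneers2015, Zhao2006, doi:10.1209/0295-5075/10/2/001
[crux] K1 of card guarneri-escape-profile-positivity — for pinnedChain (ω₂, lam, β > 0, any γ),
every T > 0 and every guarded (μ_T, D): if e^(−νt)S(0,t) is integrable on (0,∞) for all ν > 0, then
∃ C, ν₀ > 0 with ν∫₀^∞e^(−νt)Cov(h_0, h_0∘φ_t)dt ≤ C√ν for 0 < ν ≤ ν₀ — the on-site energy returns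
at least diffusively fast in Abel mean (the site-energy spectral measure is ½-Hölder at 0). [deps:
FibreCalculus, SymmetricSetup] [difficulty: open-problem] -/
@[route_item "route-AtomisticToContinuum-HoelderEscapeProfile", crux]
def LocalEnergyHalfHoelder : Prop :=
  ∀ ω₂ lam β γ : ℝ, 0 < ω₂ → 0 < lam → 0 < β → ∀ T : ℝ, 0 < T → ∀ μ : MeasureTheory.Measure Literature.MathematicalPhysics.KineticTheory.HeatConduction.ChainConfig, (Literature.MathematicalPhysics.KineticTheory.HeatConduction.pinnedChain ω₂ lam β γ).IsChainGibbsMeasure T μ → Literature.MathematicalPhysics.KineticTheory.HeatConduction.IsShiftInvariant μ → μ.map (fun σ : Literature.MathematicalPhysics.KineticTheory.HeatConduction.ChainConfig => fun x : ℤ => ((σ x).1, -(σ x).2)) = μ → ∀ D : Literature.MathematicalPhysics.KineticTheory.HeatConduction.InfiniteChainDynamics (Literature.MathematicalPhysics.KineticTheory.HeatConduction.pinnedChain ω₂ lam β γ), D.PreservesMeasure μ → (∀ t : ℝ, ∀ᵐ σ ∂μ, D.flow t (Literature.MathematicalPhysics.KineticTheory.HeatConduction.shift σ) = Literature.MathematicalPhysics.KineticTheory.HeatConduction.shift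 (D.flow t σ)) → ∀ h : Literature.MathematicalPhysics.KineticTheory.HeatConduction.ChainConfig → ℤ → ℝ, h = (fun (σ : Literature.MathematicalPhysics.KineticTheory.HeatConduction.ChainConfig) (x : ℤ) => (σ x).2 ^ 2 / 2 + (Literature.MathematicalPhysics.KineticTheory.HeatConduction.pinnedChain ω₂ lam β γ).U (σ x).1 + ((Literature.MathematicalPhysics.KineticTheory.HeatConduction.pinnedChain ω₂ lam β γ).V ((σ (x + 1)).1 - (σ x).1) + (Literature.MathematicalPhysics.KineticTheory.HeatConduction.pinnedChain ω₂ lam β γ).V ((σ x).1 - (σ (x - 1)).1)) / 2) → ∀ S : ℤ → ℝ → ℝ, S = (fun (x : ℤ) (t : ℝ) => ∫ σ, (h σ 0 - ∫ σ', h σ' 0 ∂μ) * (h (D.flow t σ) x - ∫ σ', h σ' 0 ∂μ) ∂μ) → (∀ ν : ℝ, 0 < ν → MeasureTheory.IntegrableOn (fun t : ℝ => Real.exp (-(ν * t)) * S 0 t) (Set.Ioi 0)) → ∃ C ν₀ : ℝ, 0 < ν₀ ∧ ∀ ν : ℝ, 0 < ν → ν ≤ ν₀ → ν * ∫ t in Set.Ioi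 (0:ℝ), Real.exp (-(ν * t)) * S 0 t ≤ C * Real.sqrt ν

/-- item stmt-AtomisticToContinuum-16009 · crux · rank 3 · open · by planner
why it might fail: anti-correlated currents at hydrodynamic range (negative long-range part of G_ν, an "anti-Drude" dip of the k = 0 mode) are excluded only phenomenologically; G_ν(±1) is already negative statically (Cov(V′(r_0),V′(r_1)) < 0), so no pointwise sign can be used; nothing proved for the quartic chain.
sources: BonettoLebowitzReyBellet2000, Spohn1991, Helfand1960, arXiv:1103.2835
[crux] K2 of the card (one-sided, sign-free form) — for every guarded (μ_T, D) with absolutely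
convergent current correlations and e^(−νt)Σ_x cos(kx)⟨j_0,j_x∘φ_t⟩ integrable: for every a > 0 and
ε > 0 there is ν₀ > 0 such that 𝒢_ν(k) ≤ 𝒢_ν(0) + ε for all 0 < ν ≤ ν₀ and |k| ≤ a√ν — the fibred
Abelian conductivity has no dip at k = 0 on the parabolic scale (diffusive calibration 𝒢_ν(k) =
χDν/(ν+Dk²) ≤ 𝒢_ν(0)). Structure: 𝒢_ν(k) − 𝒢_ν(0) = −Σ_x 2sin²(kx/2)G_ν(x) with G_ν(x) =
∫e^(−νt)⟨j_0,j_x∘φ_t⟩dt, so the short-range part of G_ν (any sign) moves 𝒢_ν by O(a²ν) only and the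
crux is a SIGN/continuity condition on the LONG-RANGE (|x| ≳ ν^(−½)) part alone (hydrodynamically
(χ/2)√(Dν)e^(−|x|√(ν/D)) > 0); sufficient: that part non-negative, or joint corner continuity à la
Kadanoff–Martin. [deps: FibreCalculus, SymmetricSetup] [difficulty: open-problem] -/
@[route_item "route-AtomisticToContinuum-HoelderEscapeProfile", crux]
def CornerNoDip : Prop :=
  ∀ ω₂ lam β γ : ℝ, 0 < ω₂ → 0 < lam → 0 < β → ∀ T : ℝ, 0 < T → ∀ μ : MeasureTheory.Measure Literature.MathematicalPhysics.KineticTheory.HeatConduction.ChainConfig, (Literature.MathematicalPhysics.KineticTheory.HeatConduction.pinnedChain ω₂ lam β γ).IsChainGibbsMeasure T μ → Literature.MathematicalPhysics.KineticTheory.HeatConduction.IsShiftInvariant μ → μ.map (fun σ : Literature.MathematicalPhysics.KineticTheory.HeatConduction.ChainConfig => fun x : ℤ => ((σ x).1, -(σ x).2)) = μ → ∀ D : Literature.MathematicalPhysics.KineticTheory.HeatConduction.InfiniteChainDynamics (Literature.MathematicalPhysics.KineticTheory.HeatConduction.pinnedChain ω₂ lam β γ), D.PreservesMeasure μ → (∀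 t : ℝ, ∀ᵐ σ ∂μ, D.flow t (Literature.MathematicalPhysics.KineticTheory.HeatConduction.shift σ) = Literature.MathematicalPhysics.KineticTheory.HeatConduction.shift (D.flow t σ)) → ∀ G : ℤ → ℝ → ℝ, G = (fun (x : ℤ) (t : ℝ) => ∫ σ, (Literature.MathematicalPhysics.KineticTheory.HeatConduction.pinnedChain ω₂ lam β γ).bondCurrentZ σ 0 * (Literature.MathematicalPhysics.KineticTheory.HeatConduction.pinnedChain ω₂ lam β γ).bondCurrentZ (D.flow t σ) x ∂μ) → ∀ Gh : ℝ → ℝ → ℝ, Gh = (fun (ν k : ℝ) => ∫ t in Set.Ioi (0:ℝ), Real.exp (-(ν * t)) * ∑' x : ℤ, Real.cos (k * (x : ℝ)) * G x t) → (∀ t : ℝ, D.HasAbsConvergentCorrelation μ t) → (∀ ν : ℝ, 0 < ν → ∀ k : ℝ, MeasureTheory.IntegrableOn (fun t : ℝ => Real.exp (-(ν * t)) * ∑' x : ℤ, Real.cos (k * (x : ℝ)) * G x t) (Set.Ioi 0)) → ∀ a : ℝ, 0 < a → ∀ ε : ℝ, 0 < ε → ∃ ν₀ : ℝ, 0 <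 ν₀ ∧ ∀ ν : ℝ, 0 < ν → ν ≤ ν₀ → ∀ k : ℝ, |k| ≤ a * Real.sqrt ν → Gh ν k ≤ Gh ν 0 + ε

/-- item stmt-AtomisticToContinuum-16010 · crux · rank 4 · open · by planner
why it might fail: super-diffusive episodes (a quasi-conserved phonon mode at low T, rare supersonic quartic-bond pulses, Lévy-walk-like precursor mass) could make νΣx²S̄_ν unbounded along a sequence; expected false only at lam·β = 0 but unproved.
sources: Helfand1960, arXiv:1103.2835, Dhar2008, RiederLebowitzLieb1967
[crux] finiteness input, Abel twin of CoercivePulse.LinearCeiling (stmt-15383; implied by it given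
PulseCalculus): for every guarded (μ_T, D), if e^(−νt)S(x,t) is integrable for all x, ν > 0 and
Σ_x(1+x²)|S̄_ν(x)| < ∞, then ∃ B, ν₀ > 0 with Σ_x x²S̄_ν(x) ≤ B/ν for 0 < ν ≤ ν₀ — the Abel-averaged
pulse spreads at most diffusively (calibration B = 2χD; FALSE at the harmonic member, where Σx²S̄_ν
≍ ν^(−2): the ballistic delimiter). [deps: FibreCalculus, SymmetricSetup] [difficulty: open-problem] -/
@[route_item "route-AtomisticToContinuum-HoelderEscapeProfile", crux]
def AbelSpreadCeiling : Prop :=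
  ∀ ω₂ lam β γ : ℝ, 0 < ω₂ → 0 < lam → 0 < β → ∀ T : ℝ, 0 < T → ∀ μ : MeasureTheory.Measure Literature.MathematicalPhysics.KineticTheory.HeatConduction.ChainConfig, (Literature.MathematicalPhysics.KineticTheory.HeatConduction.pinnedChain ω₂ lam β γ).IsChainGibbsMeasure T μ → Literature.MathematicalPhysics.KineticTheory.HeatConduction.IsShiftInvariant μ → μ.map (fun σ : Literature.MathematicalPhysics.KineticTheory.HeatConduction.ChainConfig => fun x : ℤ => ((σ x).1, -(σ x).2)) = μ → ∀ D : Literature.MathematicalPhysics.KineticTheory.HeatConduction.InfiniteChainDynamics (Literature.MathematicalPhysics.KineticTheory.HeatConduction.pinnedChain ω₂ lam β γ), D.PreservesMeasure μ → (∀ t : ℝ, ∀ᵐ σ ∂μ, D.flow t (Literature.MathematicalPhysics.KineticTheory.HeatConduction.shift σ) = Literature.MathematicalPhysics.KineticTheory.HeatConduction.shift (D.flow t σ)) → ∀ h : Literature.MathematicalPhysics.KineticTheory.HeatConduction.ChainConfig → ℤ → ℝ, h = (fun (σ : Literature.MathematicalPhysics.KineticTheory.HeatConduction.ChainConfig) (x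 : ℤ) => (σ x).2 ^ 2 / 2 + (Literature.MathematicalPhysics.KineticTheory.HeatConduction.pinnedChain ω₂ lam β γ).U (σ x).1 + ((Literature.MathematicalPhysics.KineticTheory.HeatConduction.pinnedChain ω₂ lam β γ).V ((σ (x + 1)).1 - (σ x).1) + (Literature.MathematicalPhysics.KineticTheory.HeatConduction.pinnedChain ω₂ lam β γ).V ((σ x).1 - (σ (x - 1)).1)) / 2) → ∀ S : ℤ → ℝ → ℝ, S = (fun (x : ℤ) (t : ℝ) => ∫ σ, (h σ 0 - ∫ σ', h σ' 0 ∂μ) * (h (D.flow t σ) x - ∫ σ', h σ' 0 ∂μ) ∂μ) → ∀ Sb : ℝ → ℤ → ℝ, Sb = (fun (ν : ℝ) (x : ℤ) => ν * ∫ t in Set.Ioi (0:ℝ), Real.exp (-(ν * t)) * S x t) → (∀ x : ℤ, ∀ ν : ℝ, 0 < ν → MeasureTheory.IntegrableOn (fun t : ℝ => Real.exp (-(ν * t)) * S x t) (Set.Ioi 0)) → (∀ ν : ℝ, 0 < ν → Summable (fun x : ℤ => (1 + (x : ℝ) ^ 2) * |Sb ν x|)) → ∃ B ν₀ : ℝ,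 0 < ν₀ ∧ ∀ ν : ℝ, 0 < ν → ν ≤ ν₀ → ∑' x : ℤ, (x : ℝ) ^ 2 * Sb ν x ≤ B / ν

/-- item stmt-AtomisticToContinuum-15384 · crux · rank 5 · open · by planner
why it might fail: lacunary/oscillating spectral mass of the current at ω = 0 (alternating power laws on dyadic shells) would make the Poisson/Abel averages oscillate; nothing known for deterministic chains excludes it.
sources: BonettoLebowitzReyBellet2000, Spohn1991, Mazur1969, Widder1941
[crux] EXISTENCE RESIDUAL, weakest Abelian form (route-repair 2026-08-16, replaces
SpectralSymmetricDerivative stmt-AtomisticToContinuum-15157; strictly weaker and exactly what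
`closes` consumes): for the same guarded (μ_T, D), if the summed current correlations converge
absolutely and e^(−νt)C_T is integrable on (0,∞) for every ν > 0, the Abel means A(ν) =
∫₀^∞e^(−νt)C_T(t)dt converge in ℝ as ν ↓ 0 OR tend to +∞ — only oscillation (liminf < limsup) is
forbidden; +∞ (Drude atom, harmonic member) and 0 (insulator) are allowed and are excluded by
LinearCeiling and LinearSpread respectively. Spectral reading: A(ν) = ∫ν/(ν²+ω²)dσ = π × Poisson
average of the current spectral measure at scale ν, so a symmetric derivative of σ at 0 implies it
(two-layer plan). [difficulty: L] -/
@[route_item "route-AtomisticToContinuum-HoelderEscapeProfile", crux]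
def AbelRegularity : Prop :=
  ∀ ω₂ lam β γ : ℝ, 0 < ω₂ → 0 < lam → 0 < β → ∀ T : ℝ, 0 < T → ∀ μ : MeasureTheory.Measure Literature.MathematicalPhysics.KineticTheory.HeatConduction.ChainConfig, (Literature.MathematicalPhysics.KineticTheory.HeatConduction.pinnedChain ω₂ lam β γ).IsChainGibbsMeasure T μ → Literature.MathematicalPhysics.KineticTheory.HeatConduction.IsShiftInvariant μ → μ.map (fun σ : Literature.MathematicalPhysics.KineticTheory.HeatConduction.ChainConfig => fun x : ℤ => ((σ x).1, -(σ x).2)) = μ → ∀ D : Literature.MathematicalPhysics.KineticTheory.HeatConduction.InfiniteChainDynamics (Literature.MathematicalPhysics.KineticTheory.HeatConduction.pinnedChain ω₂ lam β γ), D.PreservesMeasure μ → (∀ t : ℝ, ∀ᵐ σ ∂μ, D.flow t (Literature.MathematicalPhysics.KineticTheory.HeatConduction.shift σ) = Literature.MathematicalPhysics.KineticTheory.HeatConduction.shift (D.flow t σ)) → (∀ t : ℝ, D.HasAbsConvergentCorrelation μ t) → (∀ ν : ℝ, 0 < ν → MeasureTheory.IntegrableOn (fun t : ℝ => Real.exp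 (-(ν * t)) * D.currentCorrelation μ t) (Set.Ioi 0)) → (∃ L : ℝ, Filter.Tendsto (fun ν : ℝ => ∫ t in Set.Ioi (0:ℝ), Real.exp (-(ν * t)) * D.currentCorrelation μ t) (nhdsWithin (0:ℝ) (Set.Ioi 0)) (nhds L)) ∨ Filter.Tendsto (fun ν : ℝ => ∫ t in Set.Ioi (0:ℝ), Real.exp (-(ν * t)) * D.currentCorrelation μ t) (nhdsWithin (0:ℝ) (Set.Ioi 0)) Filter.atTop

/-- item stmt-AtomisticToContinuum-12596 · crux · rank 6 · SPLIT (gen 1) into UniformAbelianRegularity, ConductanceLowerBound + glue Summit.AtomisticToContinuum.FouriersLaw.Theorems.AbelThermodynamicLimit.LoomisCompactHorizonWitness.stub_cruxOfRegularityOfLowerBound · direct attempts still welcome (low priority) · by planner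
why it might fail: κ = κ_GK is unproved even formally (BLR §7); needs N-uniform low-frequency control of the thermostatted chain + o(1) contact layers while the open-chain gap closes like N⁻³ (BeckerMenegaki2022).
sources: BonettoLebowitzReyBellet2000, KunduDharNarayan2009, Dhar2008, BeckerMenegaki2022, ReyBellet2003
[crux] ABELIAN THERMODYNAMIC LIMIT, WITNESS FORM (Abelian twin of FourierGreenKubo's
ThermodynamicLimit, stmt-AtomisticToContinuum-0742; the bridge from the infinite closed chain to
clause (ii)): for pinnedChain (all > 0), under weak-NESS uniqueness and T > 0, IF some Gibbs state
μ_T with a μ_T-preserving dynamics D (absolutely convergent correlations) and some κ > 0 satisfy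
T⁻²∫₀^∞ e^{−νt}C_T(t)dt → κ as ν ↓ 0 (the Abelian Green–Kubo witness at T), THEN there is such a
witness (μ_T, D, κ), fixed before the steady-state family is chosen, such that for every
steady-state family μ and every sequence Dn of finite-volume response coefficients (Dn N = lim_{δ→0,
δ≠0} totalCurrent(μ N (T+δ/2) (T−δ/2))/δ) one has Dn → κ. Content: finite-volume Kubo formula at 0⁺
for the OPEN generator (ReyBellet2003 Rem 4.4 (56); KunduDharNarayan2009) matched N-uniformly to the
Abel-regularised CLOSED-chain correlation + o(1) contact layers (BLR (35)); no L¹ decay needed.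
[difficulty: open-problem] -/
@[route_item "route-AtomisticToContinuum-HoelderEscapeProfile", crux]
def AbelThermodynamicLimit : Prop :=
  ∀ ω₂ lam β γ : ℝ, 0 < ω₂ → 0 < lam → 0 < β → 0 < γ → (∀ (N : ℕ) (T_L T_R : ℝ), 0 < T_L → 0 < T_R → ∀ μ ν : MeasureTheory.Measure (Literature.MathematicalPhysics.KineticTheory.HeatConduction.PhaseSpace N), (Literature.MathematicalPhysics.KineticTheory.HeatConduction.pinnedChain ω₂ lam β γ).IsSteadyState N T_L T_R μ → (Literature.MathematicalPhysics.KineticTheory.HeatConduction.pinnedChain ω₂ lam β γ).IsSteadyState N T_L T_R ν → μ = ν) → ∀ T : ℝ, 0 < T → (∃ (μT : MeasureTheory.Measure Literature.MathematicalPhysics.KineticTheory.HeatConduction.ChainConfig) (D : Literature.MathematicalPhysics.KineticTheory.HeatConduction.InfiniteChainDynamics (Literature.MathematicalPhysics.KineticTheory.HeatConduction.pinnedChain ω₂ lam β γ)) (κ : ℝ), (Literature.MathematicalPhysics.KineticTheory.HeatConduction.pinnedChain ω₂ lam β γ).IsChainGibbsMeasure T μT ∧ D.PreservesMeasure μT ∧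 (∀ t : ℝ, D.HasAbsConvergentCorrelation μT t) ∧ 0 < κ ∧ Filter.Tendsto (fun ν : ℝ => (T ^ 2)⁻¹ * MeasureTheory.integral (MeasureTheory.volume.restrict (Set.Ioi (0:ℝ))) (fun t : ℝ => Real.exp (-(ν * t)) * D.currentCorrelation μT t)) (nhdsWithin (0:ℝ) (Set.Ioi 0)) (nhds κ)) → ∃ (μT : MeasureTheory.Measure Literature.MathematicalPhysics.KineticTheory.HeatConduction.ChainConfig) (D : Literature.MathematicalPhysics.KineticTheory.HeatConduction.InfiniteChainDynamics (Literature.MathematicalPhysics.KineticTheory.HeatConduction.pinnedChain ω₂ lam β γ)) (κ : ℝ), ((Literature.MathematicalPhysics.KineticTheory.HeatConduction.pinnedChain ω₂ lam β γ).IsChainGibbsMeasure T μT ∧ D.PreservesMeasure μT ∧ (∀ t : ℝ, D.HasAbsConvergentCorrelation μT t) ∧ 0 < κ ∧ Filter.Tendsto (fun ν : ℝ => (T ^ 2)⁻¹ * MeasureTheory.integral (MeasureTheory.volume.restrict (Set.Ioi (0:ℝ))) (fun t : ℝ => Real.exp (-(ν * t)) * D.currentCorrelation μT t)) (nhdsWithin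 (0:ℝ) (Set.Ioi 0)) (nhds κ)) ∧ ∀ μ : (N : ℕ) → ℝ → ℝ → MeasureTheory.Measure (Literature.MathematicalPhysics.KineticTheory.HeatConduction.PhaseSpace N), (∀ (N : ℕ) (T_L T_R : ℝ), 0 < T_L → 0 < T_R → (Literature.MathematicalPhysics.KineticTheory.HeatConduction.pinnedChain ω₂ lam β γ).IsSteadyState N T_L T_R (μ N T_L T_R)) → ∀ Dn : ℕ → ℝ, (∀ N : ℕ, Filter.Tendsto (fun δ : ℝ => (Literature.MathematicalPhysics.KineticTheory.HeatConduction.pinnedChain ω₂ lam β γ).totalCurrent (μ N (T + δ / 2) (T - δ / 2)) / δ) (nhdsWithin 0 {(0 : ℝ)}ᶜ) (nhds (Dn N))) → Filter.Tendsto Dn Filter.atTop (nhds κ)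

-- parent: AbelThermodynamicLimit · child (gen 1)
/--     item stmt-AtomisticToContinuum-13416 · crux · rank 601 · open
    parent: AbelThermodynamicLimit · by planner
    why it might fail: This IS the finiteness content (sharp HasBoundedResponse, Abelian form): slow hydrodynamic or breather modes may put ≳N weight below frequency ν (L² gap ~ N⁻³, BeckerMenegaki2022); false outright at lam = β = 0 (∫₀^∞ c_N ~ N², ballistic).
    sources: BonettoLebowitzReyBellet2000, BeckerMenegaki2022, KunduDharNarayan2009, Dhar2008, Literature.Barriers.AtomisticToContinuum.HasBoundedResponse
[crux] (R) for pinnedChain (all > 0) and T > 0: for every ε > 0 there is ν₀ > 0 such that for all ν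
∈ (0, ν₀), eventually in N, |∫₀^∞ (1 − e^(−νt)) c_N(t) dt| ≤ εN — the low-frequency (slow) part of
the open chain's equilibrium total-current autocorrelation carries o(N) weight uniformly; given
(K),(S),(G) it is EQUIVALENT to convergence of D_N (card crux 3, the shared finiteness residual in
Abelian form). [deps: KuboAbelIdentity] [difficulty: open-problem] -/
@[route_item "route-AtomisticToContinuum-HoelderEscapeProfile", crux]
def UniformAbelianRegularity : Prop :=
  ∀ ω₂ lam β γ : ℝ, 0 < ω₂ → 0 < lam → 0 < β → 0 < γ → ∀ T : ℝ, 0 < T → ∀ ε : ℝ, 0 < ε → ∃ ν₀ : ℝ, 0 < ν₀ ∧ ∀ ν : ℝ, 0 < ν → ν < ν₀ → ∃ N₀ : ℕ, ∀ N : ℕ, N₀ ≤ N → let J : Literature.MathematicalPhysics.KineticTheory.HeatConduction.PhaseSpace N → ℝ := fun z => ∑ i : Fin N, (Literature.MathematicalPhysics.KineticTheory.HeatConduction.pinnedChain ω₂ lam β γ).bondCurrent N i z; |∫ t in Set.Ioi (0:ℝ), (1 - Real.exp (-(ν * t))) * ∫ z, J z * (∫ y, J y ∂((Literature.MathematicalPhysics.KineticTheory.HeatConduction.pinnedChain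 ω₂ lam β γ).transitionKernel N T T t.toNNReal z)) ∂((Literature.MathematicalPhysics.KineticTheory.HeatConduction.pinnedChain ω₂ lam β γ).gibbsMeasure N T)| ≤ ε * N

-- parent: AbelThermodynamicLimit · child (gen 1)
/--     item stmt-AtomisticToContinuum-11749 · crux · rank 602 · open
    parent: AbelThermodynamicLimit · by planner
    why it might fail: No N-uniform lower bound on the NESS current of a deterministic anharmonic chain is in print; asymptotic localisation (DeRoeckHuveneers2015) makes c(T) super-polynomially small at low T·lam; a genuine failure (D_N → 0) would refute the conjunct itself.
    sources: DeRoeckHuveneers2015, BonettoLebowitzReyBellet2000, BernardinOlla2005, Dhar2008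
[crux] under weak-NESS uniqueness, for every steady-state family of pinnedChain ω₂ lam β γ (all >
0), T > 0 and the response coefficients D_N: ∃ c = c(ω₂,lam,β,γ,T) > 0 and N₁ with D_N ≥ c for all N
≥ N₁ (liminf_N D_N > 0; an Ohmic LOWER bound J_N ≥ c·δT/(N−1) to first order; card item K3's
positivity half). NECESSARY for the conjunct (D_N → κ(T) > 0). In the glue it caps the Fekete slope
(R_N/N ≤ 1/c), i.e. κ ≥ c. No N-uniform lower bound on the NESS current of a deterministic
anharmonic chain is in print; candidate engines: linear-response fluctuation-theorem / uncertainty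
bounds, comparison with the energy-conserving-noise chain where κ ≥ c is a theorem
(BernardinOlla2005, BasileBernardinOlla2009), multi-scale pigeonhole on the response temperature
profile (card anti-insulator-kink-rigidity); ALTERNATIVE SUPPLIER: the companion SUBadditive half
(card fekete-resistance-subadditivity: R_{N+M} ≤ R_N + R_M + C' and D_2 > 0 give R_N ≤ K·N, hence
D_N ≥ 1/(2K)). [difficulty: XL] -/
@[route_item "route-AtomisticToContinuum-HoelderEscapeProfile", crux]
def ConductanceLowerBound : Prop :=
  ∀ ω₂ lam β γ : ℝ, 0 < ω₂ → 0 < lam → 0 < β → 0 < γ → (∀ (N : ℕ) (T_L T_R : ℝ), 0 < T_L → 0 < T_R → ∀ μ ν : MeasureTheory.Measure (Literature.MathematicalPhysics.KineticTheory.HeatConduction.PhaseSpace N), (Literature.MathematicalPhysics.KineticTheory.HeatConduction.pinnedChain ω₂ lam β γ).IsSteadyState N T_L T_R μ → (Literature.MathematicalPhysics.KineticTheory.HeatConduction.pinnedChain ω₂ lam β γ).IsSteadyState N T_L T_R ν → μ = ν) → ∀ μ : (N : ℕ) → ℝ → ℝ → MeasureTheory.Measure (Literature.MathematicalPhysics.KineticTheory.HeatConduction.PhaseSpace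 N), (∀ (N : ℕ) (T_L T_R : ℝ), 0 < T_L → 0 < T_R → (Literature.MathematicalPhysics.KineticTheory.HeatConduction.pinnedChain ω₂ lam β γ).IsSteadyState N T_L T_R (μ N T_L T_R)) → ∀ T : ℝ, 0 < T → ∀ D : ℕ → ℝ, (∀ N : ℕ, Filter.Tendsto (fun δ : ℝ => (Literature.MathematicalPhysics.KineticTheory.HeatConduction.pinnedChain ω₂ lam β γ).totalCurrent (μ N (T + δ / 2) (T - δ / 2)) / δ) (nhdsWithin 0 {(0 : ℝ)}ᶜ) (nhds (D N))) → ∃ c : ℝ, 0 < c ∧ ∃ N₁ : ℕ, ∀ N : ℕ, N₁ ≤ N → c ≤ D N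

/-- glue for the split of `AbelThermodynamicLimit`: landed theorem `Summit.AtomisticToContinuum.FouriersLaw.Theorems.AbelThermodynamicLimit.LoomisCompactHorizonWitness.stub_cruxOfRegularityOfLowerBound`. -/
theorem AbelThermodynamicLimitGlueBy_holds : UniformAbelianRegularity → ConductanceLowerBound → AbelThermodynamicLimit := _root_.Summit.AtomisticToContinuum.FouriersLaw.Theorems.AbelThermodynamicLimit.LoomisCompactHorizonWitness.stub_cruxOfRegularityOfLowerBound

/-- item stmt-AtomisticToContinuum-16011 · crux · rank 7 · closed · proved by Summit.AtomisticToContinuum.FouriersLaw.Theorems.FibreCalculusSketch.fibreCalculus_proof @ 0fc0f4b53011 (prover) · by planner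
why it might fail: needs Abel-weighted light-cone bounds Σ_x(1+x²)|S(x,t)| ≲ (1+t)^m for the deg V′ = 3 infinite dynamics plus Gibbs clustering, joint measurability of the flow and the derivative exchanges behind ∂ₜ²S = Δ_xG — printed for no quartic chain as typed.
sources: LanfordLebowitzLieb1977, ButtaMarchioro2016, ButtaEtAl2007, Helfand1960, arXiv:1103.2835, BonettoLebowitzReyBellet2000
[crux] INFINITE-VOLUME FIBRE CALCULUS of the escape profile, minimal form (the identities (I1)–(I4)
of the card plus Helfand–Abel, exactly what `closes` consumes): for every guarded (μ_T, D):
absolutely convergent current correlations at every t; e^(−νt)C_T, e^(−νt)S(x,t), e^(−νt)Σ_x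
cos(kx)G(x,t) integrable on (0,∞); Σ_x(1+x²)|S̄_ν(x)| < ∞ and Σ_x(1+x²)|S(x,0)| < ∞ (light cone +
Gibbs clustering); χ = Σ_x S(x,0) > 0 and conservation Σ_x S̄_ν(x) = χ; BOCHNER f̂_ν(k) ≥ 0 (x ↦
S̄_ν(x) positive-definite via ν∫₀^∞e^(−νt)Cov(g,g∘φ_t) ≥ 0, no Stone theorem needed); Parseval at 0:
∫_(−π)^π f̂_ν = 2πS̄_ν(0); the k-space conservation law χ(k) − f̂_ν(k) = (2−2cos k)𝒢_ν(k)/ν (from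
∂ₜ²S = Δ_xG, S even in t by momentum reversal); Helfand–Abel ∫₀^∞e^(−νt)C_T = (ν/2)(Σ_x x²S̄_ν(x) −
Σ_x x²S(x,0)). [deps: SymmetricSetup] [difficulty: L] -/
@[route_item "route-AtomisticToContinuum-HoelderEscapeProfile", crux]
def FibreCalculus : Prop :=
  ∀ ω₂ lam β γ : ℝ, 0 < ω₂ → 0 < lam → 0 < β → ∀ T : ℝ, 0 < T → ∀ μ : MeasureTheory.Measure Literature.MathematicalPhysics.KineticTheory.HeatConduction.ChainConfig, (Literature.MathematicalPhysics.KineticTheory.HeatConduction.pinnedChain ω₂ lam β γ).IsChainGibbsMeasure T μ → Literature.MathematicalPhysics.KineticTheory.HeatConduction.IsShiftInvariant μ → μ.map (fun σ : Literature.MathematicalPhysics.KineticTheory.HeatConduction.ChainConfig => fun x : ℤ => ((σ x).1, -(σ x).2)) = μ → ∀ D : Literature.MathematicalPhysics.KineticTheory.HeatConduction.InfiniteChainDynamics (Literature.MathematicalPhysics.KineticTheory.HeatConduction.pinnedChain ω₂ lam β γ), D.PreservesMeasure μ → (∀ t : ℝ, ∀ᵐ σ ∂μ, D.flow t (Literature.MathematicalPhysics.KineticTheory.HeatConduction.shift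 σ) = Literature.MathematicalPhysics.KineticTheory.HeatConduction.shift (D.flow t σ)) → ∀ h : Literature.MathematicalPhysics.KineticTheory.HeatConduction.ChainConfig → ℤ → ℝ, h = (fun (σ : Literature.MathematicalPhysics.KineticTheory.HeatConduction.ChainConfig) (x : ℤ) => (σ x).2 ^ 2 / 2 + (Literature.MathematicalPhysics.KineticTheory.HeatConduction.pinnedChain ω₂ lam β γ).U (σ x).1 + ((Literature.MathematicalPhysics.KineticTheory.HeatConduction.pinnedChain ω₂ lam β γ).V ((σ (x + 1)).1 - (σ x).1) + (Literature.MathematicalPhysics.KineticTheory.HeatConduction.pinnedChain ω₂ lam β γ).V ((σ x).1 - (σ (x - 1)).1)) / 2) → ∀ S : ℤ → ℝ → ℝ, S = (fun (x : ℤ) (t : ℝ) => ∫ σ, (h σ 0 - ∫ σ', h σ' 0 ∂μ) * (h (D.flow t σ) x - ∫ σ', h σ' 0 ∂μ) ∂μ) → ∀ Sb : ℝ → ℤ → ℝ, Sb = (fun (ν : ℝ) (x : ℤ) => ν * ∫ t in Set.Ioi (0:ℝ), Real.exp (-(ν * t)) * S x t) → ∀ G : ℤ → ℝ → ℝ, G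 = (fun (x : ℤ) (t : ℝ) => ∫ σ, (Literature.MathematicalPhysics.KineticTheory.HeatConduction.pinnedChain ω₂ lam β γ).bondCurrentZ σ 0 * (Literature.MathematicalPhysics.KineticTheory.HeatConduction.pinnedChain ω₂ lam β γ).bondCurrentZ (D.flow t σ) x ∂μ) → ∀ Gh : ℝ → ℝ → ℝ, Gh = (fun (ν k : ℝ) => ∫ t in Set.Ioi (0:ℝ), Real.exp (-(ν * t)) * ∑' x : ℤ, Real.cos (k * (x : ℝ)) * G x t) → ∀ fh : ℝ → ℝ → ℝ, fh = (fun (ν k : ℝ) => ∑' x : ℤ, Real.cos (k * (x : ℝ)) * Sb ν x) → ∀ χk : ℝ → ℝ, χk = (fun k : ℝ => ∑' x : ℤ, Real.cos (k * (x : ℝ)) * S x 0) → (∀ t : ℝ, D.HasAbsConvergentCorrelation μ t) ∧ (∀ ν : ℝ, 0 < ν → MeasureTheory.IntegrableOn (fun t : ℝ => Real.exp (-(ν * t)) * D.currentCorrelation μ t) (Set.Ioi 0)) ∧ (∀ x : ℤ, ∀ ν : ℝ, 0 < ν → MeasureTheory.IntegrableOn (fun t : ℝ => Real.exp (-(ν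 * t)) * S x t) (Set.Ioi 0)) ∧ (∀ ν : ℝ, 0 < ν → Summable (fun x : ℤ => (1 + (x : ℝ) ^ 2) * |Sb ν x|)) ∧ Summable (fun x : ℤ => (1 + (x : ℝ) ^ 2) * |S x 0|) ∧ 0 < χk 0 ∧ (∀ ν : ℝ, 0 < ν → ∑' x : ℤ, Sb ν x = χk 0) ∧ (∀ ν : ℝ, 0 < ν → ∀ k : ℝ, 0 ≤ fh ν k) ∧ (∀ ν : ℝ, 0 < ν → ∫ k in (-Real.pi)..Real.pi, fh ν k = 2 * Real.pi * Sb ν 0) ∧ (∀ ν : ℝ, 0 < ν → ∀ k : ℝ, MeasureTheory.IntegrableOn (fun t : ℝ => Real.exp (-(ν * t)) * ∑' x : ℤ, Real.cos (k * (x : ℝ)) * G x t) (Set.Ioi 0)) ∧ (∀ ν : ℝ, 0 < ν → ∀ k : ℝ, χk k - fh ν k = (2 - 2 * Real.cos k) * Gh ν k / ν) ∧ (∀ ν : ℝ, 0 < ν → ∫ t in Set.Ioi (0:ℝ), Real.exp (-(ν * t)) * D.currentCorrelation μ t = ν / 2 * ((∑' x : ℤ, (x : ℝ) ^ 2 * Sb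 ν x) - ∑' x : ℤ, (x : ℝ) ^ 2 * S x 0))

-- `FibreCalculus` holds: proved by `Summit.AtomisticToContinuum.FouriersLaw.Theorems.FibreCalculusSketch.fibreCalculus_proof` @ 0fc0f4b53011 (its module imports this route file, so no `_holds` link can be stated here).

/-- item stmt-AtomisticToContinuum-11036 · crux · rank 8 · closed · proved by Summit.AtomisticToContinuum.FouriersLaw.Theorems.CurrentTiltQuench.hoelderEscapeProfile_symmetricSetup_proof @ 7ae88a1c43c2 (prover) · by planner
why it might fail: InfiniteChainDynamics demands genuine orbits AND uniqueness within an invariant carrier of full μ_T-measure and PreservesMeasure invariance of the DLR state under the a.e. flow; for deg V′ = 3 LLL 1977 Thm 1 fails (A4), Thm 4 unvendored, invariance printed only for severed flows.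
sources: LanfordLebowitzLieb1977, ButtaMarchioro2016, ButtaEtAl2007, Georgii2011, BonettoLebowitzReyBellet2000
[support] DE-VACUIFIER / infrastructure (InfiniteVolumeSetup = stmt-0743 of FourierGreenKubo
strengthened by the symmetries this line uses): for ω₂, lam, β > 0 (any γ) and T > 0 there are a DLR
Gibbs state μ_T that is shift-invariant and momentum-reversal invariant (1-D transfer operator
e^(−U/2T)e^(−V(q′−q)/T)e^(−U/2T), Hilbert–Schmidt since U ≥ ω₂q²/2: unique, hence symmetric) and an
InfiniteChainDynamics preserving μ_T whose flow commutes with the shift μ_T-a.e. (LLL1977 Thm 3 a.e.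
existence on a shift-invariant tempered carrier + a uniqueness class; ButtaEtAl2007 for quartic
forces). [difficulty: L] -/
@[route_item "route-AtomisticToContinuum-HoelderEscapeProfile", crux]
def SymmetricSetup : Prop :=
  ∀ ω₂ lam β γ : ℝ, 0 < ω₂ → 0 < lam → 0 < β → ∀ T : ℝ, 0 < T → ∃ μ : MeasureTheory.Measure Literature.MathematicalPhysics.KineticTheory.HeatConduction.ChainConfig, (Literature.MathematicalPhysics.KineticTheory.HeatConduction.pinnedChain ω₂ lam β γ).IsChainGibbsMeasure T μ ∧ Literature.MathematicalPhysics.KineticTheory.HeatConduction.IsShiftInvariant μ ∧ μ.map (fun σ : Literature.MathematicalPhysics.KineticTheory.HeatConduction.ChainConfig => fun x : ℤ => ((σ x).1, -(σ x).2)) = μ ∧ ∃ D : Literature.MathematicalPhysics.KineticTheory.HeatConduction.InfiniteChainDynamics (Literature.MathematicalPhysics.KineticTheory.HeatConduction.pinnedChain ω₂ lam β γ), D.PreservesMeasure μ ∧ ∀ t : ℝ, ∀ᵐ σ ∂μ, D.flow t (Literature.MathematicalPhysics.KineticTheory.HeatConduction.shift σ) = Literature.MathematicalPhysics.KineticTheory.HeatConduction.shift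 (D.flow t σ)

-- `SymmetricSetup` holds: proved by `Summit.AtomisticToContinuum.FouriersLaw.Theorems.CurrentTiltQuench.hoelderEscapeProfile_symmetricSetup_proof` @ 7ae88a1c43c2 (its module imports this route file, so no `_holds` link can be stated here).

-- earlier Assembly (stmt-AtomisticToContinuum-16012, replaced 2026-08-16T18:18:02Z -> stmt-AtomisticToContinuum-16313): retired by None — LocalEnergyHalfHoelder → CornerNoDip → AbelSpreadCeiling → AbelRegularity → AbelThermodynamicLimit → FibreCalculus → SymmetricSetup → FouriersLaw
-- earlier Assembly (stmt-AtomisticToContinuum-16313, replaced 2026-08-16T18:38:01Z -> stmt-AtomisticToContinuum-16350): retired by None — LocalEnergyHalfHoelder → CornerNoDip → AbelSpreadCeiling → AbelRegularity → AbelThermodynamicLimit → FibreCalculus → SymmetricSetup → NessUnique → FiniteResponseOfUnique → FouriersLaw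
/-- item stmt-AtomisticToContinuum-16350 · assembly · rank 1 · open · by planner
sources: BonettoLebowitzReyBellet2000, Helfand1960
[assembly] LocalEnergyHalfHoelder → CornerNoDip → AbelSpreadCeiling → AbelRegularity →
AbelThermodynamicLimit → FibreCalculus → SymmetricSetup → FouriersLaw (the type of the crux-only
`closes` after route-repair 2026-08-16: the seven cruxes and nothing else; the finite-N frame —
steady-state existence, weak-NESS uniqueness stmt-0741, finite-N response stmt-0717 — is invoked
inside the proof from the landed theorems). [BonettoLebowitzReyBellet2000, Helfand1960] -/
@[route_item "route-AtomisticToContinuum-HoelderEscapeProfile"]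
def Assembly : Prop :=
  LocalEnergyHalfHoelder → CornerNoDip → AbelSpreadCeiling → AbelRegularity → AbelThermodynamicLimit → FibreCalculus → SymmetricSetup → FouriersLaw

/-! D-0027 §2.1 — DECIDING THEOREM (planner-authored via `route open/edit --closes-file`; by planner-rbadge-AtomisticToContinuum-HoelderEsc-cb38dbb7-0 2026-08-16T18:38:01Z):
its hypotheses are this route's items and its conclusion the sub-problem Statement (glue_lint), and it elaborates with this file. -/

/-- D-0027 §2.1 DECIDING THEOREM, CRUX-ONLY (repair 2026-08-16): the seven cruxes decide `FouriersLaw` (pigeonhole in k,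
corner bound `A(ν) ≥ χ³/(512π²C'²)`, Helfand–Abel ceiling, Abelian dichotomy); the finite-`N` frame is taken from LANDED
kernel-closed results inside the proof: `pinnedChain_exists_isSteadyState`, `Theorems.nessUnique_proof` (stmt-0741),
`Corrector.openChainGreenKubo_holds` (`N ≥ 2`, the proof behind stmt-0717; `N ≤ 1`: no bonds). -/
@[closes "route-AtomisticToContinuum-HoelderEscapeProfile"] theorem closes (hK1 : LocalEnergyHalfHoelder) (hND : CornerNoDip) (hSC : AbelSpreadCeiling)
    (hAR : AbelRegularity) (hTL : AbelThermodynamicLimit) (hFC : FibreCalculus) (hSet : SymmetricSetup) :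
    FouriersLaw := by
  have corner : ∀ (A Ψ M χk : ℝ → ℝ) (fh Gh : ℝ → ℝ → ℝ) (M₀ C ν₀ B ν₁ : ℝ),
      0 < χk 0 → ContinuousAt χk 0 → (∀ ν, 0 < ν → Continuous (fh ν)) →
      (∀ ν, 0 < ν → fh ν 0 = χk 0) → (∀ ν, 0 < ν → ∀ k, 0 ≤ fh ν k) →
      (∀ ν, 0 < ν → ∫ k in (-Real.pi)..Real.pi, fh ν k = 2 * Real.pi * Ψ ν) →
      0 < ν₀ → (∀ ν, 0 < ν → ν ≤ ν₀ → Ψ ν ≤ C * Real.sqrt ν) →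
      (∀ ν, 0 < ν → ∀ k, χk k - fh ν k = (2 - 2 * Real.cos k) * Gh ν k / ν) →
      (∀ ν, 0 < ν → A ν = Gh ν 0) →
      (∀ a : ℝ, 0 < a → ∀ ε : ℝ, 0 < ε → ∃ ν₂ : ℝ, 0 < ν₂ ∧ ∀ ν, 0 < ν → ν ≤ ν₂ →
        ∀ k, |k| ≤ a * Real.sqrt ν → Gh ν k ≤ Gh ν 0 + ε) →
      (∀ ν, 0 < ν → A ν = ν / 2 * (M ν - M₀)) →
      0 < ν₁ → (∀ ν, 0 < ν → ν ≤ ν₁ → M ν ≤ B / ν) →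
      ((∃ L, Tendsto A (𝓝[>] 0) (𝓝 L)) ∨ Tendsto A (𝓝[>] 0) atTop) →
      ∃ κ₀, 0 < κ₀ ∧ Tendsto A (𝓝[>] 0) (𝓝 κ₀) := by
    intro A Ψ M χk fh Gh M₀ C ν₀ B ν₁ hχ hχc hfc hf0 hfn hfi hν₀ hK1 hid hA hND hH hν₁ hSC hreg
    set χ := χk 0 with hχdef
    have hup : ∀ ν, 0 < ν → ν ≤ ν₁ → ν ≤ 1 → A ν ≤ |B| / 2 + |M₀| / 2 := by
      intro ν hν h1 h2
      rw [hH ν hν]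
      have h3 : ν / 2 * M ν ≤ B / 2 :=
        calc ν / 2 * M ν ≤ ν / 2 * (B / ν) := mul_le_mul_of_nonneg_left (hSC ν hν h1) (by positivity)
          _ = B / 2 := by field_simp
      have h4 : |ν / 2 * M₀| ≤ |M₀| / 2 := by
        rw [abs_mul, abs_of_pos (by positivity : (0:ℝ) < ν / 2)]; nlinarith [abs_nonneg M₀]
      linarith [le_abs_self B, neg_abs_le (ν / 2 * M₀), mul_sub (ν / 2) (M ν) M₀]
    set C' := max C 1 with hC'
    have hC'p : 0 < C' := lt_of_lt_of_le one_pos (le_max_right _ _)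
    set a := 8 * Real.pi * C' / χ with ha
    have hap : 0 < a := by positivity
    set c₁ := χ ^ 3 / (512 * Real.pi ^ 2 * C' ^ 2) with hc₁
    have hc₁p : 0 < c₁ := by positivity
    obtain ⟨ν₂, hν₂, hND'⟩ := hND a hap c₁ hc₁p
    obtain ⟨δ, hδ, hδχ⟩ : ∃ δ > 0, ∀ k, |k| < δ → |χk k - χ| < χ / 4 := by
      obtain ⟨δ, hδ, h⟩ := Metric.continuousAt_iff.mp hχc (χ / 4) (by positivity)
      exact ⟨δ, hδ, fun k hk => by simpa [Real.dist_eq] using h (by simpa [Real.dist_eq] using hk)⟩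
    have hlow : ∀ ν, 0 < ν → ν ≤ ν₀ → ν ≤ ν₂ → a * Real.sqrt ν < δ → a * Real.sqrt ν ≤ Real.pi →
        c₁ ≤ A ν := by
      intro ν hν h0 h2 hKδ hKπ
      set K := a * Real.sqrt ν with hK
      have hsq : 0 < Real.sqrt ν := Real.sqrt_pos.mpr hν
      have hKp : 0 < K := mul_pos hap hsq
      have hΨ : Ψ ν ≤ C' * Real.sqrt ν := (hK1 ν hν h0).trans (mul_le_mul_of_nonneg_right (le_max_left _ _) hsq.le)
      obtain ⟨k, ⟨hk0, hkK⟩, hfk⟩ : ∃ k ∈ Ioc (0:ℝ) K, fh ν k ≤ χ / 2 := by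
        by_contra H
        push Not at H
        have hge : ∀ k ∈ Icc (0:ℝ) K, χ / 2 ≤ fh ν k := fun k hk => by
          rcases eq_or_lt_of_le hk.1 with h | h
          · rw [← h, hf0 ν hν]; linarith
          · exact (H k ⟨h, hk.2⟩).le
        have h1 : ∫ k in (0:ℝ)..K, (χ / 2 : ℝ) ≤ ∫ k in (0:ℝ)..K, fh ν k :=
          intervalIntegral.integral_mono_on hKp.le (by simp) ((hfc ν hν).intervalIntegrable _ _) hge
        rw [intervalIntegral.integral_const, smul_eq_mul, sub_zero] at h1
        have h2 : ∫ k in (0:ℝ)..K, fh ν k ≤ ∫ k in (-Real.pi)..Real.pi, fh ν k :=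
          intervalIntegral.integral_mono_interval (neg_nonpos.mpr Real.pi_pos.le) hKp.le hKπ
            (Eventually.of_forall fun k => hfn ν hν k) ((hfc ν hν).intervalIntegrable _ _)
        rw [hfi ν hν] at h2
        have h3 : K * (χ / 2) = 4 * Real.pi * C' * Real.sqrt ν := by rw [hK, ha]; field_simp; ring
        have h4 : 0 < Real.pi * C' * Real.sqrt ν := by positivity
        nlinarith [h1, h2, hΨ, Real.pi_pos]
      have hc1 : Real.cos k < 1 := by
        have := Real.cos_lt_cos_of_nonneg_of_le_pi le_rfl (hkK.trans hKπ) hk0; rwa [Real.cos_zero] at this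
      set d := 2 - 2 * Real.cos k with hd
      have hdp : 0 < d := by rw [hd]; linarith
      have hdk : d ≤ a ^ 2 * ν := by
        have e1 := Real.one_sub_sq_div_two_le_cos (x := k)
        have e2 : k ^ 2 ≤ K ^ 2 := pow_le_pow_left₀ hk0.le hkK 2
        rw [hK, mul_pow, Real.sq_sqrt hν.le] at e2; rw [hd]; linarith
      have hχk : 3 * χ / 4 ≤ χk k := by
        have := hδχ k (by rw [abs_of_pos hk0]; exact lt_of_le_of_lt hkK hKδ)
        rw [abs_lt] at this; linarith [this.1]
      have hpr : χ / 4 * ν ≤ d * Gh ν k := by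
        have e : (χk k - fh ν k) * ν = d * Gh ν k := by rw [hid ν hν k, hd]; field_simp
        rw [← e]; exact mul_le_mul_of_nonneg_right (by linarith) hν.le
      have hG2 : 2 * c₁ ≤ Gh ν k := by
        have e1 : Gh ν k = d * Gh ν k / d := by field_simp
        have e2 : χ / 4 * ν / d ≤ d * Gh ν k / d := div_le_div_of_nonneg_right hpr hdp.le
        have e3 : χ / 4 * ν / (a ^ 2 * ν) ≤ χ / 4 * ν / d := div_le_div_of_nonneg_left (by positivity) hdp hdk
        have e4 : χ / 4 * ν / (a ^ 2 * ν) = 2 * c₁ := by rw [ha, hc₁]; field_simp; ring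
        linarith
      have := hND' ν hν h2 k (by rw [abs_of_pos hk0]; exact hkK)
      rw [hA ν hν]; linarith
    have hpos : ∀ᶠ ν in 𝓝[>] (0:ℝ), 0 < ν := eventually_mem_nhdsWithin
    have hsm : ∀ᶠ ν in 𝓝[>] (0:ℝ), ν < min (min ν₀ ν₁) (min ν₂ 1) :=
      nhdsWithin_le_nhds (Iio_mem_nhds (by positivity))
    have hKev : ∀ᶠ ν in 𝓝[>] (0:ℝ), a * Real.sqrt ν < min δ Real.pi := by
      have : Tendsto (fun ν : ℝ => a * Real.sqrt ν) (𝓝 (0:ℝ)) (𝓝 (a * Real.sqrt 0)) :=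
        (continuous_const.mul Real.continuous_sqrt).tendsto 0
      rw [Real.sqrt_zero, mul_zero] at this
      exact (this.mono_left nhdsWithin_le_nhds).eventually (gt_mem_nhds (lt_min hδ Real.pi_pos))
    have hsand : ∀ᶠ ν in 𝓝[>] (0:ℝ), c₁ ≤ A ν ∧ A ν ≤ |B| / 2 + |M₀| / 2 := by
      filter_upwards [hpos, hsm, hKev] with ν hν hs hK
      have hs1 : ν < min ν₀ ν₁ := lt_of_lt_of_le hs (min_le_left _ _)
      have hs2 : ν < min ν₂ 1 := lt_of_lt_of_le hs (min_le_right _ _)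
      exact ⟨hlow ν hν (hs1.le.trans (min_le_left _ _)) (hs2.le.trans (min_le_left _ _))
          (lt_of_lt_of_le hK (min_le_left _ _)) (hK.le.trans (min_le_right _ _)),
        hup ν hν (hs1.le.trans (min_le_right _ _)) (hs2.le.trans (min_le_right _ _))⟩
    rcases hreg with ⟨L, hL⟩ | htop
    · exact ⟨L, lt_of_lt_of_le hc₁p (ge_of_tendsto hL (hsand.mono fun ν h => h.1)), hL⟩
    · exfalso
      obtain ⟨ν, h1, h2⟩ := (hsand.and (htop.eventually_ge_atTop (|B| / 2 + |M₀| / 2 + 1))).exists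
      linarith [h1.2]
  have cosSeries : ∀ c : ℤ → ℝ, Summable (fun x : ℤ => (1 + (x : ℝ) ^ 2) * |c x|) →
      Continuous (fun k : ℝ => ∑' x : ℤ, Real.cos (k * (x : ℝ)) * c x) := fun c hc => by
    refine continuous_tsum (fun x => (Real.continuous_cos.comp (continuous_id.mul continuous_const)).mul
      continuous_const) (Summable.of_nonneg_of_le (fun x => abs_nonneg _)
        (fun x => le_mul_of_one_le_left (abs_nonneg _) (by nlinarith [sq_nonneg (x : ℝ)])) hc) (fun x k => ?_)
    rw [Real.norm_eq_abs, abs_mul]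
    exact mul_le_of_le_one_left (abs_nonneg _) (Real.abs_cos_le_one _)
  intro ω₂ lam β γ hω hl hβ hγ
  set P := Literature.MathematicalPhysics.KineticTheory.HeatConduction.pinnedChain ω₂ lam β γ with hPdef
  -- clause (i): landed uniqueness theorem (stmt-0741)
  have hUq := Theorems.nessUnique_proof ω₂ lam β γ hω hl hβ hγ
  refine ⟨fun N T_L T_R h1 h2 => ?_, ?_⟩
  · obtain ⟨μ, hμ⟩ := Literature.MathematicalPhysics.KineticTheory.HeatConduction.pinnedChain_exists_isSteadyState
      hω hl hβ hγ N h1 h2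
    exact ⟨μ, hμ, fun ν hν => hUq N T_L T_R h1 h2 ν μ hν hμ⟩
  have hW := fun T (hT : 0 < T) => hTL ω₂ lam β γ hω hl hβ hγ hUq T hT (by
    obtain ⟨μT, hG, hSI, hRefl, D, hP, hShift⟩ := hSet ω₂ lam β γ hω hl hβ T hT
    set h : Literature.MathematicalPhysics.KineticTheory.HeatConduction.ChainConfig → ℤ → ℝ :=
      fun σ x => (σ x).2 ^ 2 / 2 + P.U (σ x).1 + (P.V ((σ (x + 1)).1 - (σ x).1) + P.V ((σ x).1 - (σ (x - 1)).1)) / 2 with hh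
    set S : ℤ → ℝ → ℝ := fun x t => ∫ σ, (h σ 0 - ∫ σ', h σ' 0 ∂μT) * (h (D.flow t σ) x - ∫ σ', h σ' 0 ∂μT) ∂μT with hS
    set Sb : ℝ → ℤ → ℝ := fun ν x => ν * ∫ t in Set.Ioi (0:ℝ), Real.exp (-(ν * t)) * S x t with hSb
    set G : ℤ → ℝ → ℝ := fun x t => ∫ σ, P.bondCurrentZ σ 0 * P.bondCurrentZ (D.flow t σ) x ∂μT with hGd
    set Gh : ℝ → ℝ → ℝ := fun ν k => ∫ t in Set.Ioi (0:ℝ), Real.exp (-(ν * t)) * ∑' x : ℤ, Real.cos (k * (x : ℝ)) * G x t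
      with hGh
    set fh : ℝ → ℝ → ℝ := fun ν k => ∑' x : ℤ, Real.cos (k * (x : ℝ)) * Sb ν x with hfh
    set χk : ℝ → ℝ := fun k => ∑' x : ℤ, Real.cos (k * (x : ℝ)) * S x 0 with hχk
    obtain ⟨hAC, hIntC, hIntS, hSumSb, hSumS0, hχpos, hcons, hBoch, hPars, hIntG, hId, hHelf⟩ :=
      hFC ω₂ lam β γ hω hl hβ T hT μT hG hSI hRefl D hP hShift h hh S hS Sb hSb G hGd Gh hGh fh hfh χk hχk
    obtain ⟨C, ν₀, hν₀, hK1'⟩ := hK1 ω₂ lam β γ hω hl hβ T hT μT hG hSI hRefl D hP hShift h hh S hS (hIntS 0)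
    obtain ⟨B, ν₁, hν₁, hSC'⟩ := hSC ω₂ lam β γ hω hl hβ T hT μT hG hSI hRefl D hP hShift h hh S hS Sb hSb hIntS hSumSb
    obtain ⟨κ₀, hκ₀, hAbel⟩ := corner (fun ν => ∫ t in Set.Ioi (0:ℝ), Real.exp (-(ν * t)) * D.currentCorrelation μT t)
      (fun ν => Sb ν 0) (fun ν => ∑' x : ℤ, (x : ℝ) ^ 2 * Sb ν x) χk fh Gh (∑' x : ℤ, (x : ℝ) ^ 2 * S x 0) C ν₀ B ν₁
      hχpos (by rw [hχk]; exact (cosSeries _ hSumS0).continuousAt)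
      (fun ν hν => by rw [hfh]; exact cosSeries _ (hSumSb ν hν))
      (fun ν hν => by simp only [hfh, zero_mul, Real.cos_zero, one_mul]; exact hcons ν hν)
      hBoch hPars hν₀ hK1' hId (fun ν hν => by simp only [hGh, hGd, zero_mul, Real.cos_zero, one_mul]; rfl)
      (hND ω₂ lam β γ hω hl hβ T hT μT hG hSI hRefl D hP hShift G hGd Gh hGh hAC hIntG) hHelf hν₁ hSC'
      (hAR ω₂ lam β γ hω hl hβ T hT μT hG hSI hRefl D hP hShift hAC hIntC)
    exact ⟨μT, D, (T ^ 2)⁻¹ * κ₀, hG, hP, hAC, mul_pos (by positivity) hκ₀, hAbel.const_mul _⟩)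
  classical
  refine ⟨fun T => if hT : 0 < T then (hW T hT).choose_spec.choose_spec.choose else 1, fun T hT => ?_, fun μ hμ T hT => ?_⟩
  · simp only [dif_pos hT]; exact (hW T hT).choose_spec.choose_spec.choose_spec.1.2.2.2.1
  · -- clause (ii): D_N exists — N ≤ 1 no bonds, N ≥ 2 landed open-chain Green–Kubo identity
    have hD : ∀ N : ℕ, ∃ D : ℝ, Tendsto (fun δ : ℝ => P.totalCurrent (μ N (T + δ / 2) (T - δ / 2)) / δ) (𝓝[≠] 0) (𝓝 D) := by
      intro N
      rcases lt_or_ge N 2 with hN | hN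
      · refine ⟨0, ?_⟩
        have key : ∀ (Q : Literature.MathematicalPhysics.KineticTheory.HeatConduction.OscillatorChain)
            (ν : Measure (Literature.MathematicalPhysics.KineticTheory.HeatConduction.PhaseSpace N)), Q.totalCurrent ν = 0 := by
          intro Q ν
          show ∑ i : Fin N, ∫ x, Q.bondCurrent N i x ∂ν = 0
          refine Finset.sum_eq_zero fun i _ => ?_
          have hj : ∀ x, Q.bondCurrent N i x = 0 := fun x => by
            unfold Literature.MathematicalPhysics.KineticTheory.HeatConduction.OscillatorChain.bondCurrent
            refine Finset.sum_eq_zero fun j _ => ?_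
            have hji : ¬ (j.val = i.val + 1) := by have := j.isLt; omega
            rw [if_neg hji]
          simp only [hj, integral_zero]
        simp only [key, zero_div]
        exact tendsto_const_nhds
      · obtain ⟨-, h2⟩ := Theorems.OddSectorIrreversibility.Corrector.openChainGreenKubo_holds
          ω₂ lam β γ hω hl hβ hγ hUq μ hμ T hT N hN
        exact ⟨_, h2⟩
    refine ⟨fun N => (hD N).choose, fun N => (hD N).choose_spec, ?_⟩
    simp only [dif_pos hT]
    exact (hW T hT).choose_spec.choose_spec.choose_spec.2 μ hμ _ fun N => (hD N).choose_spec

end Summit.AtomisticToContinuum.FouriersLaw.Theses.HoelderEscapeProfile
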